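import Literature.Computability.AlgebraicComplexity.BDS24ExponentialInterpolation
import Literature.Computability.AlgebraicComplexity.Bur24PowerSubstitution
import Summits.ValiantsHypothesis.ValiantsHypothesis.Theorems.VPBoundarySquareNbTransfer
import HarnessLib

/-!
# Bit-splitting and its Fourier formula (route `VPBoundarySquare`, aside `B_nb` = item 23487)

FILE 1a of O-L3-14 «`B_nb` is the GRH-slot» (decomp-valiant lens 3, g38). BIT-SPLITTING sends
`f = Σ_m c_m x^m` (with `deg_{x_i} f < 2^L`) to the multilinear `bitSplit L f := Σ_m c_m Π_{bit_j(m_i)=1} y_ij`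
on fresh variables `y_{σ × Fin L}`; the power substitution `y_ij ↦ x_i^{2^j}` gives `f` back
(`aeval_powerSubst_bitSplit`; Bürgisser 2024, Thm. 4.8 / Rem. 4.9). THE LEVER of the series is the
FOURIER FORMULA `bitSplit_eq_fourier` — Bhargav–Dwivedi–Saxena 2024, Lemma 4.1 in all variables:
`bitSplit L f = (2^L)^{-#σ} Σ_{k : σ → [0,2^L)} f(ω^k) Π_{i,j} (1 + ω^{-k_i 2^j} y_ij)` for a primitive
`2^L`-th root of unity `ω` — proved through CHARACTER ORTHOGONALITY on the Boolean cube of the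
bits of `k` (`sum_boolCube_char`, `sum_boolCube_interpolate`), which is the form FILE 1b
(`VPBoundarySquareNbGRHSlot`: `VNPnb^ℂ` is closed under bit-splitting, `NbCollapse → VP = VNP ∧ B_nb`)
feeds into one Boolean sum. Over `ℂ` the constants `ω` are free in `VPnb` (Bürgisser 2024, §4.2);
nothing here is constant-free, and Bürgisser's question whether `VNPnb⁰` is closed under taking
coefficients (2024, after Cor. 4.7, p0017; Malod 2007 over `𝔽_p`) is untouched. `B_nb` (item 23487)
stays open; no tag moves.

References: [BhargavDwivediSaxena2024, Lemma 4.1 (p. 13), §6 (p. 16)];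
[Burgisser2024Completeness, §4.2: Cor. 4.7, Thm. 4.8, Rem. 4.9 (p0017)].
-/

set_option linter.dupNamespace false

noncomputable section

open MvPolynomial Finset
open Literature.Computability.AlgebraicComplexity

namespace Summit.ValiantsHypothesis.ValiantsHypothesis.Theorems.VPBoundarySquareNbBitSplit

/-- The number with binary digits `b 0, …, b (ℓ-1)` (verbatim the `bitVal` of
`Literature/Algebra/EuclideanLattices/RegevRoutineDCP`, not imported here). [folklore] -/
def natVal (b : ℕ → Bool) (ℓ : ℕ) : ℕ := ∑ t ∈ range ℓ, if b t then 2 ^ t else 0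

/-- [folklore] -/
theorem natVal_succ (b : ℕ → Bool) (ℓ : ℕ) : natVal b (ℓ + 1) = natVal b ℓ + (if b ℓ then 2 ^ ℓ else 0) := by
  unfold natVal; rw [sum_range_succ]

/-- `natVal b ℓ < 2 ^ ℓ`. [folklore] -/
theorem natVal_lt (b : ℕ → Bool) : ∀ ℓ, natVal b ℓ < 2 ^ ℓ
  | 0 => by simp [natVal]
  | ℓ + 1 => by rw [natVal_succ, pow_succ]; have := natVal_lt b ℓ; split_ifs <;> omega

/-- The binary digits of `natVal b ℓ` are `b` below `ℓ` and `0` above. [folklore] -/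
theorem testBit_natVal (b : ℕ → Bool) : ∀ ℓ t, (natVal b ℓ).testBit t = (decide (t < ℓ) && b t)
  | 0, t => by simp [natVal]
  | ℓ + 1, t => by
    rw [natVal_succ]
    rcases lt_trichotomy t ℓ with h | rfl | h
    · have ih := testBit_natVal b ℓ t
      rw [show decide (t < ℓ) = true from decide_eq_true h, Bool.true_and] at ih
      rw [show decide (t < ℓ + 1) = true from decide_eq_true (by omega), Bool.true_and]
      split_ifs
      · rw [add_comm, Nat.testBit_two_pow_add_gt h, ih]
      · rw [add_zero, ih]
    · rw [show decide (t < t + 1) = true from decide_eq_true (by omega), Bool.true_and]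
      split_ifs with hb
      · rw [add_comm, Nat.testBit_two_pow_add_eq, testBit_natVal, hb]
        simp
      · rw [add_zero, testBit_natVal]
        simpa using hb
    · rw [show decide (t < ℓ + 1) = false from decide_eq_false (by omega), Bool.false_and]
      have hlt : natVal b ℓ < 2 ^ ℓ := natVal_lt b ℓ
      have hle : 2 ^ (ℓ + 1) ≤ 2 ^ t := Nat.pow_le_pow_right (by norm_num) h
      split_ifs
      · rw [Nat.testBit_eq_false_of_lt]
        rw [pow_succ] at hle
        omega
      · rw [add_zero, Nat.testBit_eq_false_of_lt]
        rw [pow_succ] at hle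
        omega

/-- Extension of a bit vector on `Fin L` by zeros. [folklore] -/
def finExt {L : ℕ} (e : Fin L → Bool) (t : ℕ) : Bool := if h : t < L then e ⟨t, h⟩ else false

/-- BDS's `binVal` (a `Fin L`-indexed sum) is `natVal` of the extension. [folklore] -/
theorem binVal_eq_natVal {L : ℕ} (e : Fin L → Bool) : binVal e = natVal (finExt e) L := by
  unfold binVal natVal
  rw [← Fin.sum_univ_eq_sum_range]
  refine sum_congr rfl fun j _ => ?_
  simp [finExt, j.isLt]

/-- `binVal e < 2 ^ L`. [folklore] -/
theorem binVal_lt_two_pow {L : ℕ} (e : Fin L → Bool) : binVal e < 2 ^ L := by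
  rw [binVal_eq_natVal]; exact natVal_lt _ _

/-- The digits of `binVal e` are `e`. [folklore] -/
theorem testBit_binVal {L : ℕ} (e : Fin L → Bool) (j : Fin L) : (binVal e).testBit j = e j := by
  rw [binVal_eq_natVal, testBit_natVal]; simp [finExt, j.isLt]

/-- Above `L` the digits of `binVal e` vanish. [folklore] -/
theorem testBit_binVal_of_le {L : ℕ} (e : Fin L → Bool) {t : ℕ} (ht : L ≤ t) :
    (binVal e).testBit t = false := by
  rw [binVal_eq_natVal, testBit_natVal]; simp [not_lt.2 ht]

/-- `binVal` is injective. [folklore] -/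
theorem binVal_injective (L : ℕ) : Function.Injective (binVal : (Fin L → Bool) → ℕ) :=
  fun e e' h => funext fun j => by rw [← testBit_binVal e j, ← testBit_binVal e' j, h]

/-- The digit vector of `m < 2 ^ L` has value `m`. [folklore] -/
theorem binVal_testBit {L m : ℕ} (hm : m < 2 ^ L) : binVal (fun j : Fin L => m.testBit j) = m := by
  refine Nat.eq_of_testBit_eq fun t => ?_
  rcases lt_or_ge t L with ht | ht
  · exact testBit_binVal (fun j : Fin L => m.testBit j) ⟨t, ht⟩
  · rw [testBit_binVal_of_le _ ht,
      Nat.testBit_eq_false_of_lt (hm.trans_le (Nat.pow_le_pow_right (by norm_num) ht))]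

/-- `Π_{j<L} (b_j ? c^{2^j} : 1) = c^{binVal b}` (the computation inside the tree's private
`aeval_boolPoint_selPow`). [folklore] -/
theorem prod_ite_pow_two_pow_eq {M : Type*} [CommMonoid M] {L : ℕ} (c : M) (b : Fin L → Bool) :
    ∏ j : Fin L, (if b j then c ^ 2 ^ (j : ℕ) else 1) = c ^ binVal b := by
  unfold binVal; rw [← prod_pow_eq_pow_sum]
  exact prod_congr rfl fun j _ => by split_ifs <;> simp

/-- `Π_{j<L} (bit_j(m) ? x^{2^j} : 1) = x^m` for `m < 2^L` (binary expansion). [folklore] -/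
theorem prod_ite_testBit_pow {M : Type*} [CommMonoid M] {L m : ℕ} (hm : m < 2 ^ L) (x : M) :
    ∏ j : Fin L, (if m.testBit j then x ^ 2 ^ (j : ℕ) else 1) = x ^ m := by
  rw [prod_ite_pow_two_pow_eq x, binVal_testBit hm]

/-- `Π_j (1 + g_j) = Σ_{b ∈ {0,1}^L} Π_{j : b_j} g_j`. [folklore] -/
theorem prod_one_add_eq_sum_boolCube {R : Type*} [CommSemiring R] {L : ℕ} (g : Fin L → R) :
    ∏ j : Fin L, (1 + g j) = ∑ b : Fin L → Bool, ∏ j : Fin L, if b j then g j else 1 := by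
  have h : ∀ j : Fin L, (1 + g j) = ∑ t : Bool, if t then g j else 1 := fun j => by
    rw [Fintype.sum_bool]; simp [add_comm]
  simp_rw [h]
  exact Fintype.prod_sum _

/-- `Π_{j<L} (1 + ξ^{2^j}) = Σ_{i<2^L} ξ^i`. [folklore] -/
theorem prod_one_add_pow_two_pow {R : Type*} [CommSemiring R] (ξ : R) :
    ∀ L : ℕ, ∏ j : Fin L, (1 + ξ ^ 2 ^ (j : ℕ)) = ∑ i ∈ range (2 ^ L), ξ ^ i
  | 0 => by simp
  | L + 1 => by
    rw [Fin.prod_univ_castSucc]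
    simp only [Fin.val_castSucc, Fin.val_last]
    rw [prod_one_add_pow_two_pow ξ L, pow_succ, mul_two, sum_range_add, mul_add, mul_one,
      mul_comm (∑ i ∈ range (2 ^ L), ξ ^ i) (ξ ^ 2 ^ L), mul_sum]
    congr 1
    exact sum_congr rfl fun x _ => (pow_add _ _ _).symm

section FieldLemmas

variable {F : Type*} [Field F]

/-- The geometric sum at a nontrivial `2^L`-th root of unity vanishes. [folklore] -/
theorem geom_sum_two_pow_eq_zero {L : ℕ} {ξ : F} (hξ : ξ ^ 2 ^ L = 1) (h : ξ ≠ 1) :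
    ∑ i ∈ range (2 ^ L), ξ ^ i = 0 := by
  have key := geom_sum_mul ξ (2 ^ L)
  rw [hξ, sub_self] at key
  exact (mul_eq_zero.mp key).resolve_right (sub_ne_zero.mpr h)

/-- CHARACTER ORTHOGONALITY on `{0,1}^L`: `Σ_b (ω^m (ω^v)⁻¹)^{binVal b} = [m = v] · 2^L` for
`m, v < 2^L` and `ω` a primitive `2^L`-th root of unity.
[cite: BhargavDwivediSaxena2024, Lemma 4.1 (p. 13)] -/
theorem sum_boolCube_char {L : ℕ} {ω : F} (hω : IsPrimitiveRoot ω (2 ^ L)) {m v : ℕ}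
    (hm : m < 2 ^ L) (hv : v < 2 ^ L) :
    ∑ b : Fin L → Bool, (ω ^ m * (ω ^ v)⁻¹) ^ binVal b = if m = v then ((2 ^ L : ℕ) : F) else 0 := by
  have hω0 : ω ≠ 0 := hω.ne_zero (pow_ne_zero L two_ne_zero)
  have h1 : ∑ b : Fin L → Bool, (ω ^ m * (ω ^ v)⁻¹) ^ binVal b =
      ∏ j : Fin L, (1 + (ω ^ m * (ω ^ v)⁻¹) ^ 2 ^ (j : ℕ)) := by
    rw [prod_one_add_eq_sum_boolCube]
    exact sum_congr rfl fun b _ => (prod_ite_pow_two_pow_eq _ b).symm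
  have hpow : (ω ^ m * (ω ^ v)⁻¹) ^ 2 ^ L = 1 := by
    rw [mul_pow, inv_pow, ← pow_mul, ← pow_mul, mul_comm m, mul_comm v, pow_mul, pow_mul,
      hω.pow_eq_one, one_pow, one_pow, inv_one, mul_one]
  rw [h1, prod_one_add_pow_two_pow]
  by_cases hmv : m = v
  · subst hmv
    rw [if_pos rfl, mul_inv_cancel₀ (pow_ne_zero _ hω0)]
    simp
  · rw [if_neg hmv]
    exact geom_sum_two_pow_eq_zero hpow fun h =>
      hmv (hω.pow_inj hm hv ((mul_inv_eq_one₀ (pow_ne_zero _ hω0)).1 h))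

/-- The constants of the double cube sum collapse to one character value. [folklore] -/
theorem pow_mul_prod_ite_inv_pow {L : ℕ} (ω : F) (m : ℕ) (b b' : Fin L → Bool) :
    (ω ^ binVal b) ^ m * ∏ j : Fin L, (if b' j then ((ω ^ 2 ^ (j : ℕ))⁻¹) ^ binVal b else 1) =
      (ω ^ m * (ω ^ binVal b')⁻¹) ^ binVal b := by
  have h2 : ∏ j : Fin L, (if b' j then ((ω ^ 2 ^ (j : ℕ))⁻¹) ^ binVal b else 1) =
      ((ω ^ binVal b')⁻¹) ^ binVal b := by
    rw [← prod_ite_pow_two_pow_eq ω b', ← prod_inv_distrib, ← prod_pow]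
    exact prod_congr rfl fun j _ => by split_ifs <;> simp
  rw [h2, ← pow_mul, mul_comm (binVal b) m, pow_mul, ← mul_pow]

/-- Splitting the constants off a cube-indexed product. [folklore] -/
theorem prod_ite_C_mul {τ : Type*} {L : ℕ} (b : Fin L → Bool) (a : Fin L → F)
    (Y : Fin L → MvPolynomial τ F) :
    ∏ j : Fin L, (if b j then C (a j) * Y j else 1) =
      C (∏ j : Fin L, if b j then a j else 1) * ∏ j : Fin L, (if b j then Y j else 1) := by
  rw [map_prod, ← prod_mul_distrib]
  exact prod_congr rfl fun j _ => by split_ifs <;> simp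

/-- Substituting constants: `p(C ∘ a) = C (p(a))`. [folklore] -/
theorem aeval_C_comp_eq_C_eval {σ τ : Type*} (a : σ → F) (p : MvPolynomial σ F) :
    aeval (fun i => (C (a i) : MvPolynomial τ F)) p = C (eval a p) := by
  induction p using MvPolynomial.induction_on with
  | C c => simp
  | add p q hp hq => simp only [map_add, hp, hq]
  | mul_X p i hp => simp only [map_mul, hp, aeval_X, eval_X]

/-- ONE-VARIABLE FOURIER INVERSION on the cube: for `m < 2^L` and arbitrary `Y_j`,
`Σ_b C((ω^{binVal b})^m) · Π_j (1 + C((ω^{2^j})^{-binVal b}) Y_j) = 2^L · Π_{j : bit_j(m)} Y_j`.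
[cite: BhargavDwivediSaxena2024, Lemma 4.1 (p. 13)] -/
theorem sum_boolCube_interpolate {τ : Type*} {L : ℕ} {ω : F} (hω : IsPrimitiveRoot ω (2 ^ L))
    {m : ℕ} (hm : m < 2 ^ L) (Y : Fin L → MvPolynomial τ F) :
    ∑ b : Fin L → Bool, C (ω ^ binVal b) ^ m *
        ∏ j : Fin L, (1 + C (((ω ^ 2 ^ (j : ℕ))⁻¹) ^ binVal b) * Y j) =
      C ((2 ^ L : ℕ) : F) * ∏ j : Fin L, (if m.testBit j then Y j else 1) := by
  have hexp : ∀ b : Fin L → Bool, C (ω ^ binVal b) ^ m *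
      ∏ j : Fin L, (1 + C (((ω ^ 2 ^ (j : ℕ))⁻¹) ^ binVal b) * Y j) =
      ∑ b' : Fin L → Bool, C ((ω ^ m * (ω ^ binVal b')⁻¹) ^ binVal b) *
        ∏ j : Fin L, (if b' j then Y j else 1) := by
    intro b
    rw [prod_one_add_eq_sum_boolCube, mul_sum]
    refine sum_congr rfl fun b' _ => ?_
    rw [prod_ite_C_mul, ← mul_assoc, ← map_pow, ← map_mul, pow_mul_prod_ite_inv_pow]
  simp_rw [hexp]; rw [sum_comm]; simp_rw [← sum_mul, ← map_sum]
  rw [Finset.sum_eq_single (fun j : Fin L => m.testBit j)]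
  · rw [sum_boolCube_char hω hm (binVal_lt_two_pow _), binVal_testBit hm, if_pos rfl]
  · intro b' _ hb'
    rw [sum_boolCube_char hω hm (binVal_lt_two_pow _), if_neg, C_0, zero_mul]
    intro h
    exact hb' (binVal_injective L (by rw [binVal_testBit hm]; exact h.symm))
  · exact fun h => absurd (mem_univ _) h

variable {σ : Type*} [Fintype σ]

/-- BIT-SPLITTING: `f = Σ_m c_m x^m ↦ Σ_m c_m Π_{i} Π_{j : bit_j(m_i) = 1} y_{ij}` on the fresh
variables `σ × Fin L` — the multilinear polynomial whose power substitution `y_ij ↦ x_i^{2^j}`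
is `f` (when `deg_{x_i} f < 2^L`). [cite: Burgisser2024Completeness, Thm. 4.8 / Rem. 4.9 (p0017)] -/
def bitSplit (L : ℕ) (p : MvPolynomial σ F) : MvPolynomial (σ × Fin L) F :=
  ∑ m ∈ p.support, C (coeff m p) * ∏ i, ∏ j : Fin L, if (m i).testBit j then X (i, j) else 1

/-- POWER SUBSTITUTION inverts bit-splitting: `(bitSplit L p)(y_ij := x_i^{2^j}) = p` if
`deg_{x_i} p < 2^L`. [cite: Burgisser2024Completeness, Thm. 4.8 (p0017)] -/
theorem aeval_powerSubst_bitSplit (L : ℕ) (p : MvPolynomial σ F)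
    (hdeg : ∀ i, p.degreeOf i < 2 ^ L) :
    aeval (fun ij : σ × Fin L => (X ij.1 : MvPolynomial σ F) ^ 2 ^ (ij.2 : ℕ)) (bitSplit L p) = p := by
  unfold bitSplit; rw [map_sum]
  conv_rhs => rw [p.as_sum]
  refine sum_congr rfl fun m hm => ?_
  rw [map_mul, aeval_C, algebraMap_eq, map_prod, monomial_eq, Finsupp.prod_fintype _ _ fun i => pow_zero _]
  congr 1
  refine prod_congr rfl fun i _ => ?_
  rw [map_prod, ← prod_ite_testBit_pow ((monomial_le_degreeOf i hm).trans_lt (hdeg i)) (X i)]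
  exact prod_congr rfl fun j _ => by split_ifs <;> simp

/-- Bit-splits are multilinear: `deg (bitSplit L p) ≤ #σ · L`. [folklore] -/
theorem totalDegree_bitSplit_le (L : ℕ) (p : MvPolynomial σ F) :
    (bitSplit L p).totalDegree ≤ Fintype.card σ * L := by
  unfold bitSplit
  refine totalDegree_finsetSum_le fun m _ => (totalDegree_mul _ _).trans ?_
  rw [totalDegree_C, zero_add]
  have h1 : ∀ (i : σ) (j : Fin L),
      (if (m i).testBit j then (X (i, j) : MvPolynomial (σ × Fin L) F) else 1).totalDegree ≤ 1 := by
    intro i j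
    split_ifs
    · exact (totalDegree_X _).le
    · exact totalDegree_one.le.trans zero_le_one
  refine (totalDegree_finsetProd _ _).trans ((sum_le_sum fun i _ =>
    (totalDegree_finsetProd _ _).trans (sum_le_sum fun j _ => h1 i j)).trans (le_of_eq ?_))
  simp

/-- FOURIER INVERSION for one monomial `x^m` (`m_i < 2^L`), all variables at once.
[cite: BhargavDwivediSaxena2024, Lemma 4.1 (p. 13)] -/
theorem sum_boolCube_interpolate_monomial [DecidableEq σ] {L : ℕ} {ω : F}
    (hω : IsPrimitiveRoot ω (2 ^ L))
    (m : σ →₀ ℕ) (hm : ∀ i, m i < 2 ^ L) :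
    ∑ b : σ → Fin L → Bool, (∏ i, C (ω ^ binVal (b i)) ^ m i) *
        ∏ i, ∏ j : Fin L, (1 + C (((ω ^ 2 ^ (j : ℕ))⁻¹) ^ binVal (b i)) *
          (X (i, j) : MvPolynomial (σ × Fin L) F)) =
      C (((2 ^ L : ℕ) : F) ^ Fintype.card σ) *
        ∏ i, ∏ j : Fin L, (if (m i).testBit j then (X (i, j) : MvPolynomial (σ × Fin L) F) else 1) := by
  simp_rw [← prod_mul_distrib]
  refine (Fintype.prod_sum fun i (β : Fin L → Bool) => C (ω ^ binVal β) ^ m i *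
    ∏ j : Fin L, (1 + C (((ω ^ 2 ^ (j : ℕ))⁻¹) ^ binVal β) *
      (X (i, j) : MvPolynomial (σ × Fin L) F))).symm.trans ?_
  refine (prod_congr rfl fun i _ => sum_boolCube_interpolate hω (hm i) fun j => X (i, j)).trans ?_
  rw [prod_mul_distrib, prod_const, card_univ, map_pow]

/-- FOURIER INVERSION on the Boolean cube: for `deg_{x_i} p < 2^L`,
`Σ_{b : σ → {0,1}^L} p(ω^{binVal b}) · Π_{i,j} (1 + (ω^{2^j})^{-binVal b_i} y_ij) = (2^L)^{#σ} · bitSplit L p`.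
[cite: BhargavDwivediSaxena2024, Lemma 4.1 (p. 13)] -/
theorem sum_boolCube_interpolate_eq_bitSplit [DecidableEq σ] {L : ℕ} {ω : F}
    (hω : IsPrimitiveRoot ω (2 ^ L))
    (p : MvPolynomial σ F) (hdeg : ∀ i, p.degreeOf i < 2 ^ L) :
    ∑ b : σ → Fin L → Bool, aeval (fun i => (C (ω ^ binVal (b i)) : MvPolynomial (σ × Fin L) F)) p *
        ∏ i, ∏ j : Fin L, (1 + C (((ω ^ 2 ^ (j : ℕ))⁻¹) ^ binVal (b i)) * X (i, j)) =
      C (((2 ^ L : ℕ) : F) ^ Fintype.card σ) * bitSplit L p := by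
  have hexp : ∀ b : σ → Fin L → Bool,
      aeval (fun i => (C (ω ^ binVal (b i)) : MvPolynomial (σ × Fin L) F)) p =
        ∑ m ∈ p.support, C (coeff m p) * ∏ i, C (ω ^ binVal (b i)) ^ m i := fun b => by
    rw [aeval_def, eval₂_eq', algebraMap_eq]
  simp_rw [hexp, sum_mul, mul_assoc]; rw [sum_comm]; simp_rw [← mul_sum]
  unfold bitSplit; rw [mul_sum]
  refine sum_congr rfl fun m hm => ?_
  rw [sum_boolCube_interpolate_monomial hω m fun i => (monomial_le_degreeOf i hm).trans_lt (hdeg i),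
    mul_left_comm]

/-- **FOURIER FORMULA FOR THE BIT-SPLIT** (BDS 2024, Lemma 4.1, all variables, frequencies
`k : σ → Fin (2^L)`): `bitSplit L p = (2^L)^{-#σ} Σ_k p(ω^k) Π_{i,j} (1 + ω^{-k_i 2^j} y_ij)`.
[cite: BhargavDwivediSaxena2024, Lemma 4.1 (p. 13)] -/
theorem bitSplit_eq_fourier [DecidableEq σ] (L : ℕ) {ω : F} (hω : IsPrimitiveRoot ω (2 ^ L))
    (p : MvPolynomial σ F) (hdeg : ∀ i, p.degreeOf i < 2 ^ L) :
    bitSplit L p = C (((2 ^ L : ℕ) : F) ^ Fintype.card σ)⁻¹ *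
      ∑ k : σ → Fin (2 ^ L), C (eval (fun i => ω ^ (k i : ℕ)) p) *
        ∏ i, ∏ j : Fin L, (1 + C ((ω ^ ((k i : ℕ) * 2 ^ (j : ℕ)))⁻¹) * X (i, j)) := by
  haveI : NeZero (2 ^ L) := ⟨pow_ne_zero L two_ne_zero⟩
  have hD : (((2 ^ L : ℕ) : F) ^ Fintype.card σ) ≠ 0 := pow_ne_zero _ (hω.neZero').out
  let Eb : (Fin L → Bool) ≃ Fin (2 ^ L) :=
    (Equiv.arrowCongr (Equiv.refl (Fin L)) finTwoEquiv.symm).trans finFunctionFinEquiv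
  have hv : ∀ b : Bool, ((finTwoEquiv.symm b : Fin 2) : ℕ) = if b then 1 else 0 := fun b => by
    cases b <;> rfl
  have hEb : ∀ e : Fin L → Bool, ((Eb e : Fin (2 ^ L)) : ℕ) = binVal e := by
    intro e
    show ((finFunctionFinEquiv (finTwoEquiv.symm ∘ e ∘ (Equiv.refl (Fin L)).symm) :
      Fin (2 ^ L)) : ℕ) = binVal e
    rw [finFunctionFinEquiv_apply, binVal]
    refine sum_congr rfl fun j _ => ?_
    simp only [Function.comp_apply, Equiv.refl_symm, Equiv.refl_apply, hv]
    split_ifs <;> simp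
  have hsum : ∑ k : σ → Fin (2 ^ L), C (eval (fun i => ω ^ (k i : ℕ)) p) *
        ∏ i, ∏ j : Fin L, (1 + C ((ω ^ ((k i : ℕ) * 2 ^ (j : ℕ)))⁻¹) *
          (X (i, j) : MvPolynomial (σ × Fin L) F)) =
      ∑ b : σ → Fin L → Bool, aeval (fun i => (C (ω ^ binVal (b i)) : MvPolynomial (σ × Fin L) F)) p *
        ∏ i, ∏ j : Fin L, (1 + C (((ω ^ 2 ^ (j : ℕ))⁻¹) ^ binVal (b i)) * X (i, j)) := by
    refine (Fintype.sum_bijective (fun (b : σ → Fin L → Bool) (i : σ) => Eb (b i))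
      (Equiv.piCongrRight fun _ : σ => Eb).bijective _ _ fun b => ?_).symm
    simp only [hEb, aeval_C_comp_eq_C_eval]
    congr 1
    refine prod_congr rfl fun i _ => prod_congr rfl fun j _ => ?_
    rw [inv_pow, ← pow_mul, mul_comm (2 ^ (j : ℕ)) (binVal (b i))]
  rw [hsum, sum_boolCube_interpolate_eq_bitSplit hω p hdeg, ← mul_assoc, ← map_mul,
    inv_mul_cancel₀ hD, C_1, one_mul]

end FieldLemmas

end Summit.ValiantsHypothesis.ValiantsHypothesis.Theorems.VPBoundarySquareNbBitSplit

end
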